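import Mathlib
import Literature.NumberTheory.LFunctions.Zhang2022.Section10Range1113MidRel
import Literature.NumberTheory.LFunctions.Zhang2022.Section8FrontEnd44Reduction
import Literature.NumberTheory.LFunctions.Zhang2022.Section8FrontEnd82
import Literature.NumberTheory.LFunctions.Zhang2022.Section12Eq1212Profiles
import HarnessLib

/-!
# Zhang (2022) §10 p. 57: the low range `dr < P^{0.5}` of `Θ₁(𝐚₁₁,𝐚₁₃)` — node `Z22:§10.u036`
# (first line), a kernel EDGE from (10.8) (relative), §8.u040/u041 and (8.10); then HOLDS

Topic `Literature/NumberTheory/LFunctions/Zhang2022` (Landau–Siegel audit tree; verdict-neutral).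
Y. Zhang, *Discrete mean estimates and the Landau–Siegel zero*, arXiv:2211.02515v1 (2022)
[Zhang2022LandauSiegel], §10 p. 57 (tex L2916–2925): "By Lemma 10.2 and the results in Section 8, the
sum over `dr < P^{0.5}` is equal to `(L′(1,χ)²/500)β_{j+1}β_{j+2}Σ_{n<P^{0.5}} |χ(n)|λ₀ⱼ(n)φ(n)⁻¹
(𝔣_{j6}(P^{0.504}/n)/0.504 + ι₂𝔣_{j7}(P^{0.5}/n)/0.5) + o(α)`" (`Typed.Sec10B.Eq1036a c′`) — **an
unrefereed manuscript under adjudication; nothing here bears on its Theorems 1–2 or on Landau–Siegel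
zeros.** ZHANG-L discharge lane (WP10, seat zl-w10-p3), leaf `Typed.Sec10B.Concl1113` (hC1113).

"Lemma 10.2 and the results in Section 8" made explicit and kernel-checked:
* the `n`-sum of `S_j(𝐚₁₁,𝐚₁₃)` at `(d,r)` is `𝔳₂ⱼ(d,r)` (`Skeleton.nSum13_eq_frakv2`), evaluated by
  (10.8) in RELATIVE form on `dr ≤ P^{0.5}/T` (tolerance `C𝓛⁻¹⁵(∏_{q∣dr}(1−q⁻¹)⁻¹)²`, the text of
  clause 1 of `Skeleton.Lemma102Rel`) and bounded on the window `P^{0.5}/T < dr ≤ P^{0.5}` by the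
  weighted window bound of record (RT-01′/R-26: `C·𝓛(1+𝓛^{1.1})⁴𝓛⁻⁹·(∏_{q∣dr}(1−q⁻¹)⁻¹)²`);
* the `m`-sum `Σ_m χ(m)(ϰ₁(nm) + ι₂ϰ₂(nm))m^{β_j−1}` is `M₁(n) + ι₂M₂(n)`, evaluated by `Z22:§8.u040`
  (`x = P₁/n > T`, all `n < P^{0.5}`) and `Z22:§8.u041` (`x = P₂/n > T`, i.e. `n < P₂/T`); on the
  window `P₂/T ≤ n ≤ P^{0.5}/T` the `ϰ₂`-part is bounded crudely
  (`Section8FrontEnd44Reduction.norm_M2_le`) or vanishes (`n ≥ P₂`);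
* the main term carries `𝔣_{j7}(P₂/n)/log P₂`, `P₂ = P^{0.5}T^{−10}`; the printed `𝔣_{j7}(P^{0.5}/n)/0.5`
  (over `log P`) differs from it by `≪ 𝓛^{1.1}𝓛⁻¹⁸` (`norm_F7_swap_le`; Lipschitz step = WP12's
  `Typed.Sec12C.norm_frakfW7_P2_sub_le`);
* (8.10) collapses `Σ_{dr=n}|μ(r)|Π(d,r)/φ(r)` to `n/φ(n)`; the range `1 ≤ n ≤ P^{0.5}/T` and the window
  `P^{0.5}/T < n < P^{0.5}` are assembled separately with L3-t4's relative assembly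
  `Typed.Sec10C.Ranges1422.range_assembly_bound₃` and the mass-7 weights; total error
  `≪ 𝓛⁻¹⁰ + 𝓛^{1.1}·𝓛^{5.5}·𝓛⁻¹⁶ = o(α)`.

Main results: `eq1036a_of_clauses` (the edge, with (10.8)ᴿ, the window bound, §8.u040, §8.u041, (8.10)
as hypotheses) and **`Typed.Sec10B.eq1036a_holds : 0 ≤ c′ → Eq1036a c′`** (every hypothesis is a tree
theorem: zl-w10-p6's `Lemma102.eq108Rel_of_lemma83Rel` / `frakv2_windows_le_of_lemma83Rel` at WP09's
`Skeleton.lemma83Rel_holds`; `Section8FrontEnd82.step8u040_holds` / `step8u041_holds`; `eq810_holds`).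

## References

* Y. Zhang, arXiv:2211.02515v1 (2022), §10 p. 57; Lemma 10.2 (10.8) p. 55; §8 p. 47 (u040/u041),
  (8.6), (8.10). [cite: Zhang2022LandauSiegel, §10 p. 57]
-/

noncomputable section

open Complex Real Finset

namespace Literature.NumberTheory.LFunctions.Zhang2022.Range1113Rel

open Skeleton Typed
open Literature.NumberTheory.LFunctions.Zhang2022.Section8cProofs (large_D)

variable (c' : ℝ) {D : ℕ} (χ : DirichletCharacter ℂ D)

/-! ## The `m`-sum of `S_j(𝐚₁₁,𝐚₁₃)` split into its `ϰ₁`- and `ϰ₂`-parts -/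

/-- `Σ_m χ(m)(ϰ₁(nm) + ι₂ϰ₂(nm))m^{−(1−β_j)} = M₁(n) + ι₂M₂(n)` with `M₁, M₂` the sums of
`Z22:§8.u040`/`u041`. [cite: Zhang2022LandauSiegel, §10 p. 57] -/
theorem mSum11_split [NeZero D] (j n : ℕ) :
    Sec10B.mSum11 c' χ j n =
      (∑ m ∈ Finset.Ico 1 (Nsupp D), χ (m : ZMod D) * vk1 D (n * m) / (m : ℂ) ^ (1 - betaJ c' D j)) +
        iota2 * ∑ m ∈ Finset.Ico 1 (Nsupp D),
          χ (m : ZMod D) * vk2 D (n * m) / (m : ℂ) ^ (1 - betaJ c' D j) := by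
  rw [Sec10B.mSum11, Finset.mul_sum, ← Finset.sum_add_distrib]
  refine Finset.sum_congr rfl fun m _ => ?_
  ring

/-- For `n ≥ P₂` the `ϰ₂`-part vanishes (`ϰ₂(nm) = 0` for `nm ≥ P₂`, `m ≥ 1`).
[cite: Zhang2022LandauSiegel, §8 (8.6)] -/
theorem M2_eq_zero [NeZero D] (j : ℕ) {n : ℕ} (hn : Skeleton.P2 D ≤ (n : ℝ)) :
    ∑ m ∈ Finset.Ico 1 (Nsupp D), χ (m : ZMod D) * vk2 D (n * m) / (m : ℂ) ^ (1 - betaJ c' D j) = 0 := by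
  refine Finset.sum_eq_zero fun m hm => ?_
  have hm1 : 1 ≤ m := (Finset.mem_Ico.mp hm).1
  have h : Skeleton.P2 D ≤ ((n * m : ℕ) : ℝ) := by
    refine hn.trans ?_
    exact_mod_cast Nat.le_mul_of_pos_right n hm1
  rw [Section8FrontEnd82.vk2_mul_eq_zero h]
  simp

/-! ## Replacing `𝔣_{j7}(P₂/n)/log P₂` by the printed `𝔣_{j7}(P^{0.5}/n)/(0.5 log P)` -/

omit χ in
/-- **The profile swap `P₂ → P^{0.5}`**: for `1 ≤ m ≤ P^{0.5}`,
`‖𝔣_{j7}(P₂/m)/log P₂ − 𝔣_{j7}(P^{0.5}/m)/(0.5·log P)‖ ≤ 10⁴·𝓛^{1.1}𝓛⁻¹⁸` (Lipschitz step plus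
`1/log P₂ − 2/log P = 10𝓛^{1.1}/(0.5𝓛⁹ log P₂)`, `log P₂ ≥ 0.4𝓛⁹`, `|𝔣_{j7}| ≤ 29`).
[cite: Zhang2022LandauSiegel, §10 p. 57] -/
theorem norm_F7_swap_le (hℓ : 3 ≤ ell D) (hc5 : 5 * |c'| * alpha D * ell D ≤ 1) (j : ℕ)
    {m : ℝ} (hm1 : 1 ≤ m) (hmP : m ≤ bigP D ^ (0.5 : ℝ)) :
    ‖frakfW c' D j 7 (Skeleton.P2 D / m) / (Real.log (Skeleton.P2 D) : ℂ) -
        frakfW c' D j 7 (bigP D ^ (0.5 : ℝ) / m) / (((0.5 * ell D ^ 9 : ℝ)) : ℂ)‖ ≤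
      10000 * ell D ^ (1.1 : ℝ) * (ell D ^ 18)⁻¹ := by
  obtain ⟨hα, hαeq, hαℓ⟩ := Sec10C.Ranges1422.alpha_facts hℓ
  have hℓ0 : 0 < ell D := by linarith
  have hm0 : 0 < m := by linarith
  obtain ⟨hP2lo, hP2hi⟩ := Sec10C.Ranges1422.log_P2_bounds (D := D) hℓ
  have hP2 : 0 < Real.log (Skeleton.P2 D) := Sec10C.Ranges1422.log_P2_pos hℓ
  have h11pos : 0 ≤ ell D ^ (1.1 : ℝ) := Real.rpow_nonneg hℓ0.le _
  set f7 := frakfW c' D j 7 (Skeleton.P2 D / m)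
  set f7' := frakfW c' D j 7 (bigP D ^ (0.5 : ℝ) / m)
  have hlp2 : (Real.log (Skeleton.P2 D) : ℂ) ≠ 0 := by exact_mod_cast hP2.ne'
  have hhalf9 : (((0.5 * ell D ^ 9 : ℝ)) : ℂ) ≠ 0 := by
    exact_mod_cast (by positivity : 0.5 * ell D ^ 9 ≠ 0)
  have e : f7 / (Real.log (Skeleton.P2 D) : ℂ) - f7' / (((0.5 * ell D ^ 9 : ℝ)) : ℂ) =
      (Real.log (Skeleton.P2 D) : ℂ)⁻¹ * (f7 - f7') +
        f7' * ((Real.log (Skeleton.P2 D) : ℂ)⁻¹ - (((0.5 * ell D ^ 9 : ℝ)) : ℂ)⁻¹) := by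
    field_simp
    ring
  rw [e]
  have hf7' : ‖f7'‖ ≤ 29 := by
    have hP1 : 1 ≤ bigP D := by
      have := Real.one_le_exp (show (0:ℝ) ≤ ell D ^ 9 by positivity); rwa [bigP]
    have hhalfP : bigP D ^ (0.5 : ℝ) ≤ bigP D := by
      calc bigP D ^ (0.5 : ℝ) ≤ bigP D ^ (1 : ℝ) := Real.rpow_le_rpow_of_exponent_le hP1 (by norm_num)
        _ = bigP D := Real.rpow_one _
    have h1half : 1 ≤ bigP D ^ (0.5 : ℝ) := by linarith
    have hΛ4 : alpha D * Real.log (bigP D) ≤ 4 := by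
      rw [bigP, Real.log_exp, hαℓ]; linarith [Real.pi_lt_d2]
    exact (Section8AbelProfiles.frakfW_div_bounds c' j 7 hα hℓ0.le hc5 h1half hhalfP hm1
      (hmP.trans hhalfP) hΛ4).2.1
  have hlip := Sec12C.norm_frakfW7_P2_sub_le c' hℓ hc5 j hm1 hmP
  have ninv : ‖(Real.log (Skeleton.P2 D) : ℂ)⁻¹‖ = (Real.log (Skeleton.P2 D))⁻¹ := by
    rw [norm_inv, Complex.norm_real, Real.norm_eq_abs, abs_of_pos hP2]
  have hsub0 : 0 ≤ (Real.log (Skeleton.P2 D))⁻¹ - (0.5 * ell D ^ 9)⁻¹ := by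
    rw [sub_nonneg]; exact inv_anti₀ hP2 hP2hi
  have ndiff : ‖(Real.log (Skeleton.P2 D) : ℂ)⁻¹ - (((0.5 * ell D ^ 9 : ℝ)) : ℂ)⁻¹‖ =
      (Real.log (Skeleton.P2 D))⁻¹ - (0.5 * ell D ^ 9)⁻¹ := by
    have : (Real.log (Skeleton.P2 D) : ℂ)⁻¹ - (((0.5 * ell D ^ 9 : ℝ)) : ℂ)⁻¹ =
        (((Real.log (Skeleton.P2 D))⁻¹ - (0.5 * ell D ^ 9)⁻¹ : ℝ) : ℂ) := by push_cast; ring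
    rw [this, Complex.norm_real, Real.norm_eq_abs, abs_of_nonneg hsub0]
  have hinvdiff : (Real.log (Skeleton.P2 D))⁻¹ - (0.5 * ell D ^ 9)⁻¹ ≤
      50 * ell D ^ (1.1 : ℝ) * (ell D ^ 18)⁻¹ := by
    have hprod : 0.2 * ell D ^ 18 ≤ Real.log (Skeleton.P2 D) * (0.5 * ell D ^ 9) := by nlinarith
    have eq1 : (Real.log (Skeleton.P2 D))⁻¹ - (0.5 * ell D ^ 9)⁻¹ =
        (0.5 * ell D ^ 9 - Real.log (Skeleton.P2 D)) / (Real.log (Skeleton.P2 D) * (0.5 * ell D ^ 9)) :=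
      inv_sub_inv hP2.ne' (by positivity)
    rw [eq1, Sec10C.Ranges1422.log_P2_eq, show 0.5 * ell D ^ 9 - (0.5 * ell D ^ 9 - 10 * ell D ^ (1.1 : ℝ)) =
      10 * ell D ^ (1.1 : ℝ) by ring, ← Sec10C.Ranges1422.log_P2_eq]
    rw [div_le_iff₀ (by positivity)]
    calc 10 * ell D ^ (1.1 : ℝ) = 50 * ell D ^ (1.1 : ℝ) * (ell D ^ 18)⁻¹ * (0.2 * ell D ^ 18) := by
          field_simp; ring
      _ ≤ 50 * ell D ^ (1.1 : ℝ) * (ell D ^ 18)⁻¹ * (Real.log (Skeleton.P2 D) * (0.5 * ell D ^ 9)) := by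
          gcongr
  have hinvle : (Real.log (Skeleton.P2 D))⁻¹ ≤ (0.4 * ell D ^ 9)⁻¹ := inv_anti₀ (by positivity) hP2lo
  calc ‖(Real.log (Skeleton.P2 D) : ℂ)⁻¹ * (f7 - f7') +
          f7' * ((Real.log (Skeleton.P2 D) : ℂ)⁻¹ - (((0.5 * ell D ^ 9 : ℝ)) : ℂ)⁻¹)‖
      ≤ ‖(Real.log (Skeleton.P2 D) : ℂ)⁻¹ * (f7 - f7')‖ +
          ‖f7' * ((Real.log (Skeleton.P2 D) : ℂ)⁻¹ - (((0.5 * ell D ^ 9 : ℝ)) : ℂ)⁻¹)‖ := norm_add_le _ _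
    _ = (Real.log (Skeleton.P2 D))⁻¹ * ‖f7 - f7'‖ +
          ‖f7'‖ * ((Real.log (Skeleton.P2 D))⁻¹ - (0.5 * ell D ^ 9)⁻¹) := by
        rw [norm_mul, norm_mul, ninv, ndiff]
    _ ≤ (0.4 * ell D ^ 9)⁻¹ * (94 * alpha D * (10 * ell D ^ (1.1 : ℝ))) +
          29 * (50 * ell D ^ (1.1 : ℝ) * (ell D ^ 18)⁻¹) := by
        gcongr
    _ = ell D ^ (1.1 : ℝ) * (ell D ^ 18)⁻¹ * (2350 * π + 1450) := by
        rw [hαeq]; field_simp; ring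
    _ ≤ ell D ^ (1.1 : ℝ) * (ell D ^ 18)⁻¹ * 10000 := by
        gcongr; linarith [Real.pi_lt_d2]
    _ = 10000 * ell D ^ (1.1 : ℝ) * (ell D ^ 18)⁻¹ := by ring

/-! ## The printed main term, collapsed -/

/-- The printed main term of `Z22:§10.u036` IS the collapsed main term of the assembly:
`(L′²/500)β_{j+1}β_{j+2}Σ_{n<P^{0.5}}|χ(n)|λ₀ⱼ(n)φ(n)⁻¹G(n) = Σ_n (|χ(n)|λ₀ⱼ(n)/n)(n/φ(n))·(L′G(n)/log P)·
(L′β_{j+1}β_{j+2}log P/500)·1`, `G(n) = 𝔣_{j6}(P^{0.504}/n)/0.504 + ι₂𝔣_{j7}(P^{0.5}/n)/0.5`.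
[cite: Zhang2022LandauSiegel, §10 p. 57] -/
theorem mainTerm1036_eq [NeZero D] (hD : 2 ≤ Real.log D) (j : ℕ) :
    deriv χ.LFunction 1 ^ 2 / 500 * (betaJ c' D (j + 1) * betaJ c' D (j + 2)) *
        Sec10B.nAvg c' χ j 0 (bigP D ^ (0.5 : ℝ)) (fun n =>
          frakfW c' D j 6 (bigP D ^ (0.504 : ℝ) / n) / 0.504 +
            iota2 * frakfW c' D j 7 (bigP D ^ (0.5 : ℝ) / n) / 0.5) =
      ∑ n ∈ (Finset.Ico 1 (Nsupp D)).filter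
          (fun n : ℕ => (0 : ℝ) ≤ (n : ℝ) ∧ (n : ℝ) < bigP D ^ (0.5 : ℝ)),
        ((‖χ (n : ZMod D)‖ : ℂ) * lamZero c' D j n / (n : ℂ)) * ((n : ℂ) / (Nat.totient n : ℂ)) *
          (deriv χ.LFunction 1 * (frakfW c' D j 6 (bigP D ^ (0.504 : ℝ) / n) / 0.504 +
              iota2 * frakfW c' D j 7 (bigP D ^ (0.5 : ℝ) / n) / 0.5) / (Real.log (bigP D) : ℂ) *
            (deriv χ.LFunction 1 * (betaJ c' D (j + 1) * betaJ c' D (j + 2)) *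
              (Real.log (bigP D) : ℂ) / 500) * 1) := by
  classical
  obtain ⟨hhiN, hP2lo, -, hP1⟩ := range_sizes (D := D) hD
  have hL0 : 0 < ell D := by rw [ell]; linarith
  have hhalf : bigP D ^ (0.5 : ℝ) < (Nsupp D : ℝ) := by
    refine lt_of_le_of_lt ?_ hhiN
    exact Real.rpow_le_rpow_of_exponent_le hP1.le (by norm_num)
  have hidx : (Finset.Ico 1 ⌈bigP D ^ (0.5 : ℝ)⌉₊).filter (fun n : ℕ => (0 : ℝ) ≤ (n : ℝ)) =
      (Finset.Ico 1 (Nsupp D)).filter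
        (fun n : ℕ => (0 : ℝ) ≤ (n : ℝ) ∧ (n : ℝ) < bigP D ^ (0.5 : ℝ)) := by
    ext n
    rw [Finset.mem_filter, Finset.mem_filter, Finset.mem_Ico, Finset.mem_Ico, Nat.lt_ceil]
    constructor
    · rintro ⟨⟨h1, h2⟩, h3⟩
      exact ⟨⟨h1, by exact_mod_cast (lt_trans h2 hhalf : (n : ℝ) < Nsupp D)⟩, h3, h2⟩
    · rintro ⟨⟨h1, -⟩, h3, h2⟩
      exact ⟨⟨h1, h2⟩, h3⟩
  rw [Sec10B.nAvg, hidx, Finset.mul_sum]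
  refine Finset.sum_congr rfl fun n hn => ?_
  have hn0 : (n : ℂ) ≠ 0 := by
    have : 1 ≤ n := (Finset.mem_Ico.mp (Finset.mem_filter.mp hn).1).1
    exact_mod_cast (show n ≠ 0 by omega)
  have hφ0 : (Nat.totient n : ℂ) ≠ 0 := by
    have : 1 ≤ n := (Finset.mem_Ico.mp (Finset.mem_filter.mp hn).1).1
    exact_mod_cast (Nat.totient_pos.mpr (by omega)).ne'
  have hlogbigP : (Real.log (bigP D) : ℂ) ≠ 0 := by
    rw [log_bigP]; exact_mod_cast (by positivity : ell D ^ 9 ≠ 0)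
  field_simp

/-! ## Scalar endgame and weights for the low range -/

omit χ in
/-- The numeric endgame for the two integer-exponent pieces of the low range: `W₁A₁ + W₂A₂ ≤ (ε/2)π𝓛⁻⁹`
for `W₁ ≤ 2e^{256}𝓛⁹`, `A₁ ≤ K₁𝓛⁻²¹`, `W₂ ≤ 12e^{256}𝓛²`, `A₂ ≤ K₂𝓛⁻¹²`, once
`𝓛 ≥ 2(2e^{256}K₁ + 12e^{256}K₂)/(επ)` (`𝓛 ≥ 1`). [cite: Zhang2022LandauSiegel, §10 p. 57] -/
theorem final_bound_low {L ε K₁ K₂ W₁ W₂ A₁ A₂ : ℝ} (hL1 : 1 ≤ L) (hε : 0 < ε) (hK₁ : 0 ≤ K₁)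
    (hK₂ : 0 ≤ K₂) (hA₁0 : 0 ≤ A₁) (hA₂0 : 0 ≤ A₂)
    (hW₁ : W₁ ≤ 2 * Real.exp 256 * L ^ 9) (hW₂ : W₂ ≤ 12 * Real.exp 256 * L ^ 2)
    (hA₁ : A₁ ≤ K₁ * (L ^ 21)⁻¹) (hA₂ : A₂ ≤ K₂ * (L ^ 12)⁻¹)
    (hLX : 2 * (2 * Real.exp 256 * K₁ + 12 * Real.exp 256 * K₂) / (ε * π) ≤ L) :
    W₁ * A₁ + W₂ * A₂ ≤ ε / 2 * (π / L ^ 9) := by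
  have hL0 : 0 < L := by linarith
  set K : ℝ := 2 * Real.exp 256 * K₁ + 12 * Real.exp 256 * K₂ with hK
  have hK0 : 0 ≤ K := by positivity
  have step1 : W₁ * A₁ + W₂ * A₂ ≤
      (2 * Real.exp 256 * L ^ 9) * (K₁ * (L ^ 21)⁻¹) +
        (12 * Real.exp 256 * L ^ 2) * (K₂ * (L ^ 12)⁻¹) := by
    gcongr
  have e1 : 2 * Real.exp 256 * L ^ 9 * (K₁ * (L ^ 21)⁻¹) = 2 * Real.exp 256 * K₁ * (L ^ 12)⁻¹ := by
    field_simp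
  have e2 : 12 * Real.exp 256 * L ^ 2 * (K₂ * (L ^ 12)⁻¹) = 12 * Real.exp 256 * K₂ * (L ^ 10)⁻¹ := by
    field_simp
  have h1210 : (L ^ 12)⁻¹ ≤ (L ^ 10)⁻¹ := by
    rw [inv_le_inv₀ (by positivity) (by positivity)]
    exact pow_le_pow_right₀ hL1 (by norm_num)
  have step2 : 2 * Real.exp 256 * K₁ * (L ^ 12)⁻¹ + 12 * Real.exp 256 * K₂ * (L ^ 10)⁻¹ ≤
      K * (L ^ 10)⁻¹ := by
    rw [hK, add_mul]
    have : 2 * Real.exp 256 * K₁ * (L ^ 12)⁻¹ ≤ 2 * Real.exp 256 * K₁ * (L ^ 10)⁻¹ :=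
      mul_le_mul_of_nonneg_left h1210 (by positivity)
    linarith
  have hKle' : K ≤ ε * π * L / 2 := by
    have := hLX; rw [div_le_iff₀ (by positivity)] at this; linarith
  have step3 : K * (L ^ 10)⁻¹ ≤ ε / 2 * (π / L ^ 9) := by
    rw [show ε / 2 * (π / L ^ 9) = (ε * π * L / 2) * (L ^ 10)⁻¹ by field_simp]
    exact mul_le_mul_of_nonneg_right hKle' (by positivity)
  calc W₁ * A₁ + W₂ * A₂ ≤ _ := step1
    _ = 2 * Real.exp 256 * K₁ * (L ^ 12)⁻¹ + 12 * Real.exp 256 * K₂ * (L ^ 10)⁻¹ := by rw [e1, e2]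
    _ ≤ K * (L ^ 10)⁻¹ := step2
    _ ≤ ε / 2 * (π / L ^ 9) := step3

/-! ## The main step: `Z22:§10.u036`, first line, from the relative clauses -/

set_option maxHeartbeats 1600000 in -- one long two-range assembly
/-- **`Z22:§10.u036` (first line) from (10.8) in RELATIVE form, the weighted window bound, §8.u040/u041
and (8.10).** The typed display `Typed.Sec10B.Eq1036a c′` FOLLOWS (kernel-checked) from: clause (10.8)
of Lemma 10.2 in relative form (text of clause 1 of `Skeleton.Lemma102Rel`), the window clause in the
weighted form of record (`‖𝔳₂ⱼ(d,r)‖ ≤ C·𝓛(1+𝓛^{1.1})⁴𝓛⁻⁹(∏_{q∣dr}(1−q⁻¹)⁻¹)²` on the three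
`T`-windows), the `m`-sum evaluations `Z22:§8.u040`, `Z22:§8.u041` (`Section8cStatements.Step8u040/041`)
and (8.10) (`Section8cStatements.Eq810`) — all CLAIMS of the manuscript (or their repaired readings of
record) taken as hypotheses. The range `n = dr ≤ P^{0.5}/T` (main part `n < P₂/T`, window
`P₂/T ≤ n ≤ P^{0.5}/T` where the `ϰ₂`-part of the `m`-sum is only crudely bounded) and the window
`P^{0.5}/T < n < P^{0.5}` are assembled separately; error `O(𝓛⁻¹⁰) + O(𝓛^{−9.4}) = o(α)`.
[cite: Zhang2022LandauSiegel, §10 p. 57] -/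
theorem eq1036a_of_clauses
    (h8 : ∃ C : ℝ, ForAllLarge fun D _ χ => AssumptionA D χ →
      ∀ j ∈ ({1, 2, 3} : Finset ℕ), ∀ d r : ℕ, 1 ≤ d → 1 ≤ r →
        ((d * r : ℕ) : ℝ) ≤ bigP D ^ (0.5 : ℝ) / bigT D →
        ‖frakv2 c' χ j d r - deriv χ.LFunction 1 * PiW χ d r / 500 *
            (betaJ c' D (j + 1) * betaJ c' D (j + 2)) * Real.log (bigP D)‖ ≤
          C * (ell D ^ 15)⁻¹ * (∏ q ∈ (d * r).primeFactors, (1 - (q : ℝ)⁻¹)⁻¹) ^ 2)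
    (hW : ∃ C : ℝ, ForAllLarge fun D _ χ => AssumptionA D χ →
      ∀ j ∈ ({1, 2, 3} : Finset ℕ), ∀ d r : ℕ, 1 ≤ d → 1 ≤ r →
        ((bigP D ^ (0.5 : ℝ) / bigT D < ((d * r : ℕ) : ℝ) ∧ ((d * r : ℕ) : ℝ) ≤ bigP D ^ (0.5 : ℝ)) ∨
            (bigP D ^ (0.502 : ℝ) / bigT D < ((d * r : ℕ) : ℝ) ∧
              ((d * r : ℕ) : ℝ) ≤ bigP D ^ (0.502 : ℝ)) ∨
            (bigP D ^ (0.504 : ℝ) / bigT D < ((d * r : ℕ) : ℝ) ∧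
              ((d * r : ℕ) : ℝ) < bigP D ^ (0.504 : ℝ))) →
        ‖frakv2 c' χ j d r‖ ≤
          C * (ell D * (1 + ell D ^ (1.1 : ℝ)) ^ 4 * (ell D ^ 9)⁻¹) *
            (∏ q ∈ (d * r).primeFactors, (1 - (q : ℝ)⁻¹)⁻¹) ^ 2)
    (h40 : Section8cStatements.Step8u040 c') (h41 : Section8cStatements.Step8u041 c')
    (h810 : Section8cStatements.Eq810) : Sec10B.Eq1036a c' := by
  classical
  intro ε hε
  obtain ⟨C₁, H₁⟩ := h8
  obtain ⟨Cw, HW⟩ := hW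
  obtain ⟨C₄₀, H40⟩ := h40
  obtain ⟨C₄₁, H41⟩ := h41
  -- one constant for both Lemma-10.2 clauses
  set C₀ : ℝ := max |C₁| |Cw| with hC₀
  have hC₀1 : |C₁| ≤ C₀ := le_max_left _ _
  have hC₀w : |Cw| ≤ C₀ := le_max_right _ _
  have hC₀0 : 0 ≤ C₀ := le_trans (abs_nonneg _) hC₀1
  -- named constants
  set cL : ℝ := 4 * Real.exp (9 / 2) with hcL
  set cc : ℝ := 16 * cL * π ^ 2 / 500 with hcc            -- `‖c₀‖ ≤ cc·𝓛⁻⁷`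
  set KeM : ℝ := |C₄₀| + 2 * |C₄₁| + 20000 * cL with hKeM  -- `e_M ≤ KeM·𝓛⁻¹⁴`
  set K₁ : ℝ := (174 * cL + KeM) * C₀ + KeM * cc with hK₁   -- main coefficient `≤ K₁𝓛⁻²¹`
  set K₂ : ℝ := (58 * cL + |C₄₀| + 10) * (cc + C₀) + 174 * cL * cc with hK₂ -- window-a `≤ K₂𝓛⁻¹²`
  set Ka : ℝ := (58 * cL + |C₄₀|) * C₀ with hKa            -- window-b
  set Kb : ℝ := 174 * cL * cc with hKb
  have hcL0 : 0 ≤ cL := by positivity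
  have hcc0 : 0 ≤ cc := by positivity
  have hKeM0 : 0 ≤ KeM := by positivity
  have hK₁0 : 0 ≤ K₁ := by positivity
  have hK₂0 : 0 ≤ K₂ := by positivity
  have hKa0 : 0 ≤ Ka := by positivity
  have hKb0 : 0 ≤ Kb := by positivity
  set X : ℝ := 2 * (2 * Real.exp 256 * K₁ + 12 * Real.exp 256 * K₂) / (ε * π) +
    2 * (3 * Real.exp 256 * 0 + 6 * Real.exp 256 * Kb) / (ε / 2 * π) +
    (2 * (160 * Real.exp 256 * Ka) / (ε / 2 * π)) ^ 2 + 5 with hX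
  obtain ⟨D₀, hH⟩ := (H₁.and HW).and (H40.and H41)
  refine ⟨max D₀ (max ⌈Real.exp (π * |5 * c'| + 5)⌉₊ ⌈Real.exp X⌉₊), fun D _ χ hD hq hp hA j hj => ?_⟩
  have hD₀ : D₀ ≤ D := le_trans (le_max_left _ _) hD
  have hDc : ⌈Real.exp (π * |5 * c'| + 5)⌉₊ ≤ D :=
    le_trans (le_trans (le_max_left _ _) (le_max_right _ _)) hD
  have hDX : ⌈Real.exp X⌉₊ ≤ D := le_trans (le_trans (le_max_right _ _) (le_max_right _ _)) hD
  obtain ⟨hL5, hα, hc5'⟩ := large_D (c' := 5 * c') hDc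
  have hc5 : 5 * |c'| * alpha D * ell D ≤ 1 := by
    have : |5 * c'| = 5 * |c'| := by rw [abs_mul, abs_of_pos (by norm_num : (0:ℝ) < 5)]
    rw [this] at hc5'; exact hc5'
  have hLX : X ≤ ell D := by
    have h : Real.exp X ≤ D := le_trans (Nat.le_ceil _) (by exact_mod_cast hDX)
    rw [ell]; exact (Real.le_log_iff_exp_le (lt_of_lt_of_le (Real.exp_pos _) h)).mpr h
  obtain ⟨⟨H₁', HW'⟩, H40', H41'⟩ := hH D χ hD₀ hq hp
  replace H₁' := H₁' hA j hj
  replace HW' := HW' hA j hj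
  replace H40' := H40' hA j hj
  replace H41' := H41' hA j hj
  ------------------------------------------------------------------
  -- parameters
  ------------------------------------------------------------------
  have hlog2 : 2 ≤ Real.log D := by have h := hL5; rw [ell] at h; linarith
  have hL3 : (3 : ℝ) ≤ ell D := by linarith
  have hL2 : (2 : ℝ) ≤ ell D := by linarith
  have hL1 : (1 : ℝ) ≤ ell D := by linarith
  have hL0 : (0 : ℝ) < ell D := by linarith
  have hαeq : alpha D = π / ell D ^ 9 := by rw [alpha, bigP, Real.log_exp]
  have hαL : alpha D * ell D ^ 9 = π := by rw [hαeq]; field_simp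
  obtain ⟨hhiN, hP2lo, hT1, hP1⟩ := range_sizes (D := D) hlog2
  obtain ⟨h11, hTlt⟩ := bigT_lt_rpow hL5
  have hP : 0 < bigP D := Real.exp_pos _
  have hP1' : 1 ≤ bigP D := hP1.le
  have hlogP : Real.log (bigP D) = ell D ^ 9 := log_bigP D
  have hlogPpos : 0 < Real.log (bigP D) := by rw [hlogP]; positivity
  have hΛ4 : alpha D * Real.log (bigP D) ≤ 4 := by rw [hlogP, hαL]; linarith [Real.pi_lt_d2]
  have hT0 : 0 < bigT D := by linarith
  have hT1' : 1 < bigT D := by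
    rw [bigT]; exact Real.one_lt_exp_iff.mpr (Real.rpow_pos_of_pos hL0 _)
  have hτ0 : 0 ≤ ell D ^ (1.1 : ℝ) := Real.rpow_nonneg hL0.le _
  have hlogT : Real.log (bigT D) = ell D ^ (1.1 : ℝ) := by rw [bigT, Real.log_exp]
  have hhalf_exp : bigP D ^ (0.5 : ℝ) = Real.exp (0.5 * ell D ^ 9) := bigP_rpow D 0.5
  have hhalf0 : 0 < bigP D ^ (0.5 : ℝ) := Real.rpow_pos_of_pos hP _
  have hhalf1 : 1 ≤ bigP D ^ (0.5 : ℝ) := Real.one_le_rpow hP1' (by norm_num)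
  have hhalfP : bigP D ^ (0.5 : ℝ) ≤ bigP D := by
    calc bigP D ^ (0.5 : ℝ) ≤ bigP D ^ (1 : ℝ) := Real.rpow_le_rpow_of_exponent_le hP1' (by norm_num)
      _ = bigP D := Real.rpow_one _
  have h504_1 : 1 ≤ bigP D ^ (0.504 : ℝ) := Real.one_le_rpow hP1' (by norm_num)
  have h504_P : bigP D ^ (0.504 : ℝ) ≤ bigP D := by
    calc bigP D ^ (0.504 : ℝ) ≤ bigP D ^ (1 : ℝ) := Real.rpow_le_rpow_of_exponent_le hP1' (by norm_num)
      _ = bigP D := Real.rpow_one _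
  have hhalfN : bigP D ^ (0.5 : ℝ) < (Nsupp D : ℝ) :=
    lt_of_le_of_lt (Real.rpow_le_rpow_of_exponent_le hP1' (by norm_num)) hhiN
  have hP1_exp : Skeleton.P1 D = Real.exp (0.504 * ell D ^ 9) := bigP_rpow D 0.504
  have hlogP1 : Real.log (Skeleton.P1 D) = 0.504 * ell D ^ 9 := by rw [hP1_exp, Real.log_exp]
  have hlogP1pos : 0 < Real.log (Skeleton.P1 D) := by rw [hlogP1]; positivity
  have hP2one : 1 < Skeleton.P2 D := Sec10C.Ranges1422.one_lt_P2 hL3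
  have hP2P : Skeleton.P2 D < bigP D := Sec10C.Ranges1422.P2_lt_bigP hL3
  have hlogP2 : Real.log (Skeleton.P2 D) = 0.5 * ell D ^ 9 - 10 * ell D ^ (1.1 : ℝ) :=
    Sec10C.Ranges1422.log_P2_eq D
  obtain ⟨hlogP2lo, hlogP2hi⟩ := Sec10C.Ranges1422.log_P2_bounds (D := D) hL3
  have hlogP2pos : 0 < Real.log (Skeleton.P2 D) := Sec10C.Ranges1422.log_P2_pos hL3
  have hP2T_exp : Skeleton.P2 D / bigT D = Real.exp (0.5 * ell D ^ 9 - 11 * ell D ^ (1.1 : ℝ)) := by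
    have : Skeleton.P2 D = Real.exp (Real.log (Skeleton.P2 D)) :=
      (Real.exp_log (by linarith)).symm
    rw [this, hlogP2, bigT, ← Real.exp_sub]; ring_nf
  have hhalfT_exp : bigP D ^ (0.5 : ℝ) / bigT D = Real.exp (0.5 * ell D ^ 9 - ell D ^ (1.1 : ℝ)) := by
    rw [hhalf_exp, bigT, ← Real.exp_sub]
  have h59 : (1953125 : ℝ) ≤ ell D ^ 9 := by
    have h := pow_le_pow_left₀ (by norm_num : (0:ℝ) ≤ 5) hL5 9
    norm_num at h
    exact h
  have h7L : (78125 : ℝ) * ell D ^ 2 ≤ ell D ^ 9 := by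
    have hL7 : (78125 : ℝ) ≤ ell D ^ 7 := by
      have h := pow_le_pow_left₀ (by norm_num : (0:ℝ) ≤ 5) hL5 7
      norm_num at h
      exact h
    calc (78125 : ℝ) * ell D ^ 2 ≤ ell D ^ 7 * ell D ^ 2 := by gcongr
      _ = ell D ^ 9 := by ring
  -- the three thresholds inside the range
  have hP2T_lt_halfT : Skeleton.P2 D / bigT D < bigP D ^ (0.5 : ℝ) / bigT D := by
    rw [hP2T_exp, hhalfT_exp, Real.exp_lt_exp]; linarith [Real.rpow_pos_of_pos hL0 (1.1 : ℝ)]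
  have hhalfT_lt_half : bigP D ^ (0.5 : ℝ) / bigT D < bigP D ^ (0.5 : ℝ) := div_lt_self hhalf0 hT1'
  have hP2T_two : (2 : ℝ) < Skeleton.P2 D / bigT D := by
    rw [hP2T_exp]
    have hlt : Real.log 2 < 0.5 * ell D ^ 9 - 11 * ell D ^ (1.1 : ℝ) := by
      have h2pos : 0 < ell D ^ 2 := pow_pos hL0 2
      have := Real.log_two_lt_d9
      linarith [h11, h7L, h59]
    calc (2 : ℝ) = Real.exp (Real.log 2) := (Real.exp_log (by norm_num)).symm
      _ < _ := Real.exp_lt_exp.mpr hlt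
  have hP2_le_halfT : Skeleton.P2 D ≤ bigP D ^ (0.5 : ℝ) / bigT D := by
    rw [Skeleton.P2, div_le_div_iff_of_pos_left hhalf0 (pow_pos hT0 10) hT0]
    calc bigT D = bigT D ^ 1 := (pow_one _).symm
      _ ≤ bigT D ^ 10 := pow_le_pow_right₀ hT1'.le (by norm_num)
  have hhalf_lt_P1T : bigP D ^ (0.5 : ℝ) < Skeleton.P1 D / bigT D := by
    rw [lt_div_iff₀ hT0, Skeleton.P1]
    calc bigP D ^ (0.5 : ℝ) * bigT D < bigP D ^ (0.5 : ℝ) * bigP D ^ (0.002 : ℝ) := by gcongr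
      _ = bigP D ^ (0.502 : ℝ) := by rw [← Real.rpow_add hP]; norm_num
      _ ≤ bigP D ^ (0.504 : ℝ) := Real.rpow_le_rpow_of_exponent_le hP1' (by norm_num)
  ------------------------------------------------------------------
  -- the exact layer: re-indexing and the main term
  ------------------------------------------------------------------
  have hMT0 := mainTerm1036_eq c' χ hlog2 j
  have hreidx0 := drSum_reindex c' χ j (Sec10B.mSum11 c' χ j) (Sec10B.nSum13 c' χ j)
    (lo := 0) hhalfN
  set M : ℕ → ℂ := Sec10B.mSum11 c' χ j with hMdef
  set N : ℕ → ℕ → ℂ := Sec10B.nSum13 c' χ j with hNdef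
  set S : Finset ℕ := (Finset.Ico 1 (Nsupp D)).filter
    (fun n : ℕ => (0 : ℝ) ≤ (n : ℝ) ∧ (n : ℝ) < bigP D ^ (0.5 : ℝ)) with hSdef
  -- the objects of the abstract assembly (opaque names with defining equations)
  obtain ⟨a, hadef⟩ : ∃ a : ℕ → ℂ, a = fun n : ℕ => (‖χ (n : ZMod D)‖ : ℂ) * lamZero c' D j n / (n : ℂ) :=
    ⟨_, rfl⟩
  obtain ⟨M₀, hM₀def⟩ : ∃ M₀ : ℕ → ℂ, M₀ = fun n : ℕ => deriv χ.LFunction 1 *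
      (frakfW c' D j 6 (bigP D ^ (0.504 : ℝ) / n) / 0.504 +
        iota2 * frakfW c' D j 7 (bigP D ^ (0.5 : ℝ) / n) / 0.5) / (Real.log (bigP D) : ℂ) := ⟨_, rfl⟩
  obtain ⟨G, hGdef⟩ : ∃ G : ℕ → ℂ, G = fun _ : ℕ => (1 : ℂ) := ⟨_, rfl⟩
  obtain ⟨c₀, hc₀def⟩ : ∃ c₀ : ℂ, c₀ = deriv χ.LFunction 1 *
      (betaJ c' D (j + 1) * betaJ c' D (j + 2)) * (Real.log (bigP D) : ℂ) / 500 := ⟨_, rfl⟩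
  obtain ⟨main, hmaindef⟩ : ∃ main : ℕ → Prop, main = fun n : ℕ => (n : ℝ) < Skeleton.P2 D / bigT D :=
    ⟨_, rfl⟩
  obtain ⟨inner, hinnerdef⟩ : ∃ inner : ℕ → Prop,
      inner = fun n : ℕ => (n : ℝ) ≤ bigP D ^ (0.5 : ℝ) / bigT D := ⟨_, rfl⟩
  haveI : DecidablePred main := fun n => by rw [hmaindef]; infer_instance
  haveI : DecidablePred inner := fun n => by rw [hinnerdef]; infer_instance
  have hmemS : ∀ {n : ℕ}, n ∈ S → 1 ≤ n ∧ (n : ℝ) < bigP D ^ (0.5 : ℝ) := by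
    intro n hn
    rw [hSdef, Finset.mem_filter, Finset.mem_Ico] at hn
    exact ⟨hn.1.1, hn.2.2⟩
  have hSne : ∀ n ∈ S, n ≠ 0 := fun n hn => by have := (hmemS hn).1; omega
  -- the two sub-ranges
  set S₁ : Finset ℕ := S.filter inner with hS₁
  set S₂ : Finset ℕ := S.filter (fun n => ¬ inner n) with hS₂
  have hS₁ne : ∀ n ∈ S₁, n ≠ 0 := fun n hn => hSne n (Finset.mem_of_mem_filter n hn)
  have hS₂ne : ∀ n ∈ S₂, n ≠ 0 := fun n hn => hSne n (Finset.mem_of_mem_filter n hn)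
  have hmemS₁ : ∀ {n : ℕ}, n ∈ S₁ → 1 ≤ n ∧ (n : ℝ) ≤ bigP D ^ (0.5 : ℝ) / bigT D := by
    intro n hn
    rw [hS₁, Finset.mem_filter, hinnerdef] at hn
    exact ⟨(hmemS hn.1).1, hn.2⟩
  have hmemS₂ : ∀ {n : ℕ}, n ∈ S₂ → 1 ≤ n ∧ bigP D ^ (0.5 : ℝ) / bigT D < (n : ℝ) ∧
      (n : ℝ) < bigP D ^ (0.5 : ℝ) := by
    intro n hn
    rw [hS₂, Finset.mem_filter, hinnerdef] at hn
    exact ⟨(hmemS hn.1).1, not_le.mp hn.2, (hmemS hn.1).2⟩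
  -- the relative factor at `n = (n/r)·r`
  have hrel : ∀ {n : ℕ}, n ≠ 0 → ∀ r ∈ n.divisors,
      (∏ q ∈ (n / r * r).primeFactors, (1 - (q : ℝ)⁻¹)⁻¹) ^ 2 = ((n : ℝ) / Nat.totient n) ^ 2 := by
    intro n hn r hr
    rw [Nat.div_mul_cancel (Nat.mem_divisors.mp hr).1]
    exact Sj1321Mid.prod_one_sub_inv_inv_sq_eq hn
  ------------------------------------------------------------------
  -- sizes
  ------------------------------------------------------------------
  have hLp : ‖deriv χ.LFunction 1‖ ≤ cL * ell D ^ 2 := norm_deriv_LFunction_one_le χ (by linarith) hp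
  have hβ1 := Section8AbelProfiles.norm_betaJ_le c' hα.le hL0.le hc5 (j + 1)
  have hβ2 := Section8AbelProfiles.norm_betaJ_le c' hα.le hL0.le hc5 (j + 2)
  have hPr : ‖betaJ c' D (j + 1) * betaJ c' D (j + 2)‖ ≤ (4 * alpha D) * (4 * alpha D) := by
    rw [norm_mul]; exact mul_le_mul hβ1 hβ2 (norm_nonneg _) (by positivity)
  have hi2 : ‖iota2‖ ≤ 2 := Section8FrontEnd44Sizes.norm_iota2_le_two
  -- `‖c₀‖ ≤ cc·𝓛⁻⁷`
  have hc₀' : ‖c₀‖ ≤ cc * (ell D ^ 7)⁻¹ := by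
    rw [hc₀def, norm_div, norm_mul, norm_mul, Complex.norm_real, Real.norm_of_nonneg hlogPpos.le,
      hlogP, show ‖(500 : ℂ)‖ = 500 by norm_num]
    calc ‖deriv χ.LFunction 1‖ * ‖betaJ c' D (j + 1) * betaJ c' D (j + 2)‖ * ell D ^ 9 / 500
        ≤ (cL * ell D ^ 2) * ((4 * alpha D) * (4 * alpha D)) * ell D ^ 9 / 500 := by gcongr
      _ = cc * (ell D ^ 7)⁻¹ := by rw [hcc, hαeq]; field_simp; ring
  -- the profile values at integer points of the range
  have hf6 : ∀ {n : ℕ}, 1 ≤ n → (n : ℝ) ≤ bigP D →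
      ‖frakfW c' D j 6 (bigP D ^ (0.504 : ℝ) / n)‖ ≤ 29 := by
    intro n hn1 hnP
    exact (Section8AbelProfiles.frakfW_div_bounds c' j 6 hα hL0.le hc5 h504_1 h504_P
      (by exact_mod_cast hn1) hnP hΛ4).2.1
  have hf7 : ∀ {n : ℕ}, 1 ≤ n → (n : ℝ) ≤ bigP D →
      ‖frakfW c' D j 7 (bigP D ^ (0.5 : ℝ) / n)‖ ≤ 29 := by
    intro n hn1 hnP
    exact (Section8AbelProfiles.frakfW_div_bounds c' j 7 hα hL0.le hc5 hhalf1 hhalfP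
      (by exact_mod_cast hn1) hnP hΛ4).2.1
  have hf6P1 : ∀ {n : ℕ}, 1 ≤ n → (n : ℝ) ≤ bigP D →
      ‖frakfW c' D j 6 (Skeleton.P1 D / n)‖ ≤ 29 := fun hn1 hnP => by
    rw [Skeleton.P1]; exact hf6 hn1 hnP
  -- `‖M₀ n‖ ≤ BM`
  set BM : ℝ := cL * ell D ^ 2 * 174 / ell D ^ 9 with hBMdef
  have hBM0 : 0 ≤ BM := by positivity
  have hM₀ : ∀ n ∈ S, ‖M₀ n‖ ≤ BM := by
    intro n hn
    obtain ⟨hn1, hnh⟩ := hmemS hn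
    have hnP : (n : ℝ) ≤ bigP D := (hnh.le).trans hhalfP
    have hGn : ‖frakfW c' D j 6 (bigP D ^ (0.504 : ℝ) / n) / 0.504 +
        iota2 * frakfW c' D j 7 (bigP D ^ (0.5 : ℝ) / n) / 0.5‖ ≤ 174 := by
      have e504 : ‖(0.504 : ℂ)‖ = 0.504 := by norm_num
      have e5 : ‖(0.5 : ℂ)‖ = 0.5 := by norm_num
      calc _ ≤ ‖frakfW c' D j 6 (bigP D ^ (0.504 : ℝ) / n) / 0.504‖ +
            ‖iota2 * frakfW c' D j 7 (bigP D ^ (0.5 : ℝ) / n) / 0.5‖ := norm_add_le _ _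
        _ = ‖frakfW c' D j 6 (bigP D ^ (0.504 : ℝ) / n)‖ / 0.504 +
            ‖iota2‖ * ‖frakfW c' D j 7 (bigP D ^ (0.5 : ℝ) / n)‖ / 0.5 := by
            rw [norm_div, norm_div, norm_mul, e504, e5]
        _ ≤ 29 / 0.504 + 2 * 29 / 0.5 := by gcongr <;> [exact hf6 hn1 hnP; exact hf7 hn1 hnP]
        _ ≤ 174 := by norm_num
    rw [hM₀def]
    simp only
    rw [norm_div, norm_mul, Complex.norm_real, Real.norm_of_nonneg hlogPpos.le, hlogP, hBMdef]
    rw [div_le_div_iff_of_pos_right (by positivity)]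
    exact mul_le_mul hLp hGn (norm_nonneg _) (by positivity)
  have hG : ∀ n ∈ S₁, ‖G n‖ ≤ 1 := fun n _ => by rw [hGdef]; simp
  have hG₂ : ∀ n ∈ S₂, ‖G n‖ ≤ 1 := fun n _ => by rw [hGdef]; simp
  ------------------------------------------------------------------
  -- the `m`-sum: `M = M₁ + ι₂M₂`
  ------------------------------------------------------------------
  -- §8.u040 at `(d,r) = (n,1)`: `‖M₁(n) − L′𝔣_{j6}(P₁/n)/log P₁‖ ≤ C₄₀𝓛⁻¹⁵` for all `n < P^{0.5}`
  have hM1 : ∀ n ∈ S,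
      ‖(∑ m ∈ Finset.Ico 1 (Nsupp D), χ (m : ZMod D) * vk1 D (n * m) / (m : ℂ) ^ (1 - betaJ c' D j)) -
          deriv χ.LFunction 1 / (Real.log (Skeleton.P1 D) : ℂ) * frakfW c' D j 6 (Skeleton.P1 D / n)‖ ≤
        |C₄₀| * (ell D ^ 15)⁻¹ := by
    intro n hn
    obtain ⟨hn1, hnh⟩ := hmemS hn
    have hlt : ((n * 1 : ℕ) : ℝ) < Skeleton.P1 D / bigT D := by
      rw [mul_one]; exact hnh.trans hhalf_lt_P1T
    have h := H40' n 1 hn1 le_rfl hlt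
    simp only [mul_one] at h
    exact h.trans (mul_le_mul_of_nonneg_right (le_abs_self _) (by positivity))
  -- §8.u041 at `(n,1)`: `‖M₂(n) − L′𝔣_{j7}(P₂/n)/log P₂‖ ≤ C₄₁𝓛⁻¹⁵` for `n < P₂/T`
  have hM2 : ∀ n ∈ S, main n →
      ‖(∑ m ∈ Finset.Ico 1 (Nsupp D), χ (m : ZMod D) * vk2 D (n * m) / (m : ℂ) ^ (1 - betaJ c' D j)) -
          deriv χ.LFunction 1 / (Real.log (Skeleton.P2 D) : ℂ) * frakfW c' D j 7 (Skeleton.P2 D / n)‖ ≤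
        |C₄₁| * (ell D ^ 15)⁻¹ := by
    intro n hn hmain
    obtain ⟨hn1, -⟩ := hmemS hn
    rw [hmaindef] at hmain
    have hlt : ((n * 1 : ℕ) : ℝ) < Skeleton.P2 D / bigT D := by rw [mul_one]; exact hmain
    have h := H41' n 1 hn1 le_rfl hlt
    simp only [mul_one] at h
    exact h.trans (mul_le_mul_of_nonneg_right (le_abs_self _) (by positivity))
  -- the main value of the `m`-sum vs the printed one: profile swap
  have hswap : ∀ n ∈ S,
      ‖deriv χ.LFunction 1 / (Real.log (Skeleton.P1 D) : ℂ) * frakfW c' D j 6 (Skeleton.P1 D / n) +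
          iota2 * (deriv χ.LFunction 1 / (Real.log (Skeleton.P2 D) : ℂ) *
            frakfW c' D j 7 (Skeleton.P2 D / n)) - M₀ n‖ ≤
        2 * (cL * ell D ^ 2) * (10000 * ell D ^ (1.1 : ℝ) * (ell D ^ 18)⁻¹) := by
    intro n hn
    obtain ⟨hn1, hnh⟩ := hmemS hn
    have hn1R : (1 : ℝ) ≤ n := by exact_mod_cast hn1
    have hsw := norm_F7_swap_le c' hL3 hc5 j hn1R hnh.le
    have hlogP1C : (Real.log (Skeleton.P1 D) : ℂ) = 0.504 * (Real.log (bigP D) : ℂ) := by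
      rw [hlogP1, hlogP]; push_cast; ring
    have hhalf9C : (((0.5 * ell D ^ 9 : ℝ)) : ℂ) = 0.5 * (Real.log (bigP D) : ℂ) := by
      rw [hlogP]; push_cast; ring
    have hlogPC : (Real.log (bigP D) : ℂ) ≠ 0 := by exact_mod_cast hlogPpos.ne'
    have e : deriv χ.LFunction 1 / (Real.log (Skeleton.P1 D) : ℂ) * frakfW c' D j 6 (Skeleton.P1 D / n) +
          iota2 * (deriv χ.LFunction 1 / (Real.log (Skeleton.P2 D) : ℂ) *
            frakfW c' D j 7 (Skeleton.P2 D / n)) - M₀ n =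
        iota2 * deriv χ.LFunction 1 *
          (frakfW c' D j 7 (Skeleton.P2 D / n) / (Real.log (Skeleton.P2 D) : ℂ) -
            frakfW c' D j 7 (bigP D ^ (0.5 : ℝ) / n) / (((0.5 * ell D ^ 9 : ℝ)) : ℂ)) := by
      rw [hM₀def]
      simp only
      rw [hlogP1C, hhalf9C, Skeleton.P1]
      field_simp
      ring
    rw [e, norm_mul, norm_mul]
    calc ‖iota2‖ * ‖deriv χ.LFunction 1‖ * _ ≤ 2 * (cL * ell D ^ 2) *
          (10000 * ell D ^ (1.1 : ℝ) * (ell D ^ 18)⁻¹) := by gcongr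
      _ = _ := rfl
  -- eM: the `m`-sum tolerance on the main part
  set eM : ℝ := KeM * (ell D ^ 14)⁻¹ with heMdef
  have heM0 : 0 ≤ eM := by positivity
  have hM : ∀ n ∈ S₁, main n → ‖M n - M₀ n‖ ≤ eM := by
    intro n hn hmain
    have hnS : n ∈ S := Finset.mem_of_mem_filter n hn
    have h1 := hM1 n hnS
    have h2 := hM2 n hnS hmain
    have h3 := hswap n hnS
    have hsplit := mSum11_split c' χ j n
    -- triangle inequality
    set M1 := ∑ m ∈ Finset.Ico 1 (Nsupp D), χ (m : ZMod D) * vk1 D (n * m) / (m : ℂ) ^ (1 - betaJ c' D j)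
    set M2 := ∑ m ∈ Finset.Ico 1 (Nsupp D), χ (m : ZMod D) * vk2 D (n * m) / (m : ℂ) ^ (1 - betaJ c' D j)
    set A1 := deriv χ.LFunction 1 / (Real.log (Skeleton.P1 D) : ℂ) * frakfW c' D j 6 (Skeleton.P1 D / n)
    set A2 := deriv χ.LFunction 1 / (Real.log (Skeleton.P2 D) : ℂ) * frakfW c' D j 7 (Skeleton.P2 D / n)
    have hMn : M n = M1 + iota2 * M2 := by rw [hMdef]; exact hsplit
    have e : M n - M₀ n = (M1 - A1) + iota2 * (M2 - A2) + ((A1 + iota2 * A2) - M₀ n) := by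
      rw [hMn]; ring
    rw [e]
    have hle : ‖(M1 - A1) + iota2 * (M2 - A2) + ((A1 + iota2 * A2) - M₀ n)‖ ≤
        |C₄₀| * (ell D ^ 15)⁻¹ + 2 * (|C₄₁| * (ell D ^ 15)⁻¹) +
          2 * (cL * ell D ^ 2) * (10000 * ell D ^ (1.1 : ℝ) * (ell D ^ 18)⁻¹) := by
      calc _ ≤ ‖M1 - A1‖ + ‖iota2 * (M2 - A2)‖ + ‖(A1 + iota2 * A2) - M₀ n‖ := norm_add₃_le
        _ ≤ |C₄₀| * (ell D ^ 15)⁻¹ + 2 * (|C₄₁| * (ell D ^ 15)⁻¹) +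
            2 * (cL * ell D ^ 2) * (10000 * ell D ^ (1.1 : ℝ) * (ell D ^ 18)⁻¹) := by
            gcongr
            · rw [norm_mul]; exact mul_le_mul hi2 h2 (norm_nonneg _) (by norm_num)
    refine hle.trans ?_
    -- `≤ KeM·𝓛⁻¹⁴`
    rw [heMdef, hKeM]
    have h15 : (ell D ^ 15)⁻¹ ≤ (ell D ^ 14)⁻¹ := by
      rw [inv_le_inv₀ (by positivity) (by positivity)]; exact pow_le_pow_right₀ hL1 (by norm_num)
    have hsw' : ell D ^ 2 * (ell D ^ (1.1 : ℝ) * (ell D ^ 18)⁻¹) ≤ (ell D ^ 14)⁻¹ := by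
      calc ell D ^ 2 * (ell D ^ (1.1 : ℝ) * (ell D ^ 18)⁻¹) ≤ ell D ^ 2 * (ell D ^ 2 * (ell D ^ 18)⁻¹) := by
            gcongr
        _ = (ell D ^ 14)⁻¹ := by field_simp
    have t1 := mul_le_mul_of_nonneg_left h15 (abs_nonneg C₄₀)
    have t2 := mul_le_mul_of_nonneg_left h15 (abs_nonneg C₄₁)
    have t3 := mul_le_mul_of_nonneg_left hsw' (by positivity : (0 : ℝ) ≤ 20000 * cL)
    have e3 : 2 * (cL * ell D ^ 2) * (10000 * ell D ^ (1.1 : ℝ) * (ell D ^ 18)⁻¹) =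
        20000 * cL * (ell D ^ 2 * (ell D ^ (1.1 : ℝ) * (ell D ^ 18)⁻¹)) := by ring
    rw [e3]
    linarith
  -- window-a: the crude `m`-sum bound (`ϰ₂`-part crude or zero)
  set BWa : ℝ := (58 * cL + |C₄₀| + 10) * (ell D ^ 5)⁻¹ with hBWadef
  have hBWa0 : 0 ≤ BWa := by positivity
  have hMWa : ∀ n ∈ S₁, ¬ main n → ‖M n‖ ≤ BWa := by
    intro n hn hmain
    have hnS : n ∈ S := Finset.mem_of_mem_filter n hn
    obtain ⟨hn1, hnh⟩ := hmemS hnS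
    rw [hmaindef] at hmain
    have hnge : Skeleton.P2 D / bigT D ≤ (n : ℝ) := not_lt.mp hmain
    have hnP : (n : ℝ) ≤ bigP D := hnh.le.trans hhalfP
    have h1 := hM1 n hnS
    set M1 := ∑ m ∈ Finset.Ico 1 (Nsupp D), χ (m : ZMod D) * vk1 D (n * m) / (m : ℂ) ^ (1 - betaJ c' D j)
    set M2 := ∑ m ∈ Finset.Ico 1 (Nsupp D), χ (m : ZMod D) * vk2 D (n * m) / (m : ℂ) ^ (1 - betaJ c' D j)
    set A1 := deriv χ.LFunction 1 / (Real.log (Skeleton.P1 D) : ℂ) * frakfW c' D j 6 (Skeleton.P1 D / n)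
    have hMn : M n = M1 + iota2 * M2 := by rw [hMdef]; exact mSum11_split c' χ j n
    -- `‖M₁‖ ≤ ‖A1‖ + C₄₀𝓛⁻¹⁵ ≤ 58cL𝓛⁻⁷ + |C₄₀|𝓛⁻¹⁵`
    have hA1 : ‖A1‖ ≤ 58 * cL * (ell D ^ 7)⁻¹ := by
      have : ‖A1‖ = ‖deriv χ.LFunction 1‖ / Real.log (Skeleton.P1 D) *
          ‖frakfW c' D j 6 (Skeleton.P1 D / n)‖ := by
        rw [norm_mul, norm_div, Complex.norm_real, Real.norm_of_nonneg hlogP1pos.le]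
      rw [this, hlogP1]
      calc ‖deriv χ.LFunction 1‖ / (0.504 * ell D ^ 9) * ‖frakfW c' D j 6 (Skeleton.P1 D / n)‖
          ≤ (cL * ell D ^ 2) / (0.504 * ell D ^ 9) * 29 := by gcongr; exact hf6P1 hn1 hnP
        _ = (29 / 0.504) * cL * (ell D ^ 7)⁻¹ := by field_simp
        _ ≤ 58 * cL * (ell D ^ 7)⁻¹ := by gcongr; norm_num
    have hM1n : ‖M1‖ ≤ 58 * cL * (ell D ^ 7)⁻¹ + |C₄₀| * (ell D ^ 15)⁻¹ := by
      have := norm_le_norm_add_norm_sub' M1 A1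
      linarith
    -- `‖M₂‖ ≤ 5𝓛⁻⁵` (crude, or zero)
    have hM2n : ‖M2‖ ≤ 5 * (ell D ^ 5)⁻¹ := by
      by_cases hnP2 : (n : ℝ) < Skeleton.P2 D
      · have h := Section8FrontEnd44Reduction.norm_M2_le c' χ hL2 j hn1 hnP2
        refine h.trans ?_
        have hn0 : (0 : ℝ) < n := by exact_mod_cast hn1
        have hx1 : 1 ≤ Skeleton.P2 D / n := by rw [le_div_iff₀ hn0, one_mul]; exact hnP2.le
        have hlx0 : 0 ≤ Real.log (Skeleton.P2 D / n) := Real.log_nonneg hx1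
        have hlxT : Real.log (Skeleton.P2 D / n) ≤ ell D ^ (1.1 : ℝ) := by
          rw [← hlogT]
          refine Real.log_le_log (by positivity) ?_
          rw [div_le_iff₀ hn0]
          calc Skeleton.P2 D = Skeleton.P2 D / bigT D * bigT D := by field_simp
            _ ≤ n * bigT D := by gcongr
            _ = bigT D * n := mul_comm _ _
        have hlx2 : Real.log (Skeleton.P2 D / n) ≤ ell D ^ 2 := hlxT.trans h11
        calc Real.log (Skeleton.P2 D / n) / Real.log (Skeleton.P2 D) * (1 + Real.log (Skeleton.P2 D / n))
            ≤ ell D ^ 2 / (0.4 * ell D ^ 9) * (1 + ell D ^ 2) := by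
              gcongr
          _ ≤ ell D ^ 2 / (0.4 * ell D ^ 9) * (2 * ell D ^ 2) := by
              gcongr; linarith [one_le_pow₀ (M₀ := ℝ) hL1 (n := 2)]
          _ = 5 * (ell D ^ 5)⁻¹ := by field_simp; ring
      · have hz : M2 = 0 := M2_eq_zero c' χ j (not_lt.mp hnP2)
        rw [hz, norm_zero]; positivity
    rw [hMn]
    calc ‖M1 + iota2 * M2‖ ≤ ‖M1‖ + ‖iota2‖ * ‖M2‖ := by
          refine (norm_add_le _ _).trans ?_; rw [norm_mul]
      _ ≤ (58 * cL * (ell D ^ 7)⁻¹ + |C₄₀| * (ell D ^ 15)⁻¹) + 2 * (5 * (ell D ^ 5)⁻¹) := by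
          gcongr
      _ ≤ BWa := by
          rw [hBWadef]
          have h7 : (ell D ^ 7)⁻¹ ≤ (ell D ^ 5)⁻¹ := by
            rw [inv_le_inv₀ (by positivity) (by positivity)]; exact pow_le_pow_right₀ hL1 (by norm_num)
          have h15 : (ell D ^ 15)⁻¹ ≤ (ell D ^ 5)⁻¹ := by
            rw [inv_le_inv₀ (by positivity) (by positivity)]; exact pow_le_pow_right₀ hL1 (by norm_num)
          have t1 := mul_le_mul_of_nonneg_left h7 (by positivity : (0 : ℝ) ≤ 58 * cL)
          have t2 := mul_le_mul_of_nonneg_left h15 (abs_nonneg C₄₀)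
          linarith
  -- window-b: the `ϰ₂`-part vanishes, `‖M‖ ≤ 58cL𝓛⁻⁷ + |C₄₀|𝓛⁻¹⁵`
  set BWb : ℝ := 58 * cL * (ell D ^ 7)⁻¹ + |C₄₀| * (ell D ^ 15)⁻¹ with hBWbdef
  have hBWb0 : 0 ≤ BWb := by positivity
  have hMWb : ∀ n ∈ S₂, ¬ False → ‖M n‖ ≤ BWb := by
    intro n hn _
    have hnS : n ∈ S := Finset.mem_of_mem_filter n hn
    obtain ⟨hn1, hlo, hnh⟩ := hmemS₂ hn
    have hnP : (n : ℝ) ≤ bigP D := hnh.le.trans hhalfP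
    have h1 := hM1 n hnS
    set M1 := ∑ m ∈ Finset.Ico 1 (Nsupp D), χ (m : ZMod D) * vk1 D (n * m) / (m : ℂ) ^ (1 - betaJ c' D j)
    set A1 := deriv χ.LFunction 1 / (Real.log (Skeleton.P1 D) : ℂ) * frakfW c' D j 6 (Skeleton.P1 D / n)
    have hz : ∑ m ∈ Finset.Ico 1 (Nsupp D), χ (m : ZMod D) * vk2 D (n * m) / (m : ℂ) ^ (1 - betaJ c' D j)
        = 0 := M2_eq_zero c' χ j (hP2_le_halfT.trans hlo.le)
    have hMn : M n = M1 := by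
      rw [hMdef, mSum11_split c' χ j n, hz, mul_zero, add_zero]
    have hA1 : ‖A1‖ ≤ 58 * cL * (ell D ^ 7)⁻¹ := by
      have : ‖A1‖ = ‖deriv χ.LFunction 1‖ / Real.log (Skeleton.P1 D) *
          ‖frakfW c' D j 6 (Skeleton.P1 D / n)‖ := by
        rw [norm_mul, norm_div, Complex.norm_real, Real.norm_of_nonneg hlogP1pos.le]
      rw [this, hlogP1]
      calc ‖deriv χ.LFunction 1‖ / (0.504 * ell D ^ 9) * ‖frakfW c' D j 6 (Skeleton.P1 D / n)‖
          ≤ (cL * ell D ^ 2) / (0.504 * ell D ^ 9) * 29 := by gcongr; exact hf6P1 hn1 hnP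
        _ = (29 / 0.504) * cL * (ell D ^ 7)⁻¹ := by field_simp
        _ ≤ 58 * cL * (ell D ^ 7)⁻¹ := by gcongr; norm_num
    rw [hMn, hBWbdef]
    have := norm_le_norm_add_norm_sub' M1 A1
    linarith
  ------------------------------------------------------------------
  -- the `n`-sum
  ------------------------------------------------------------------
  have hNfacts : ∀ {n : ℕ}, n ≠ 0 → ∀ r ∈ n.divisors,
      1 ≤ n / r ∧ 1 ≤ r ∧ ((n / r * r : ℕ) : ℝ) = n ∧ N (n / r) r = frakv2 c' χ j (n / r) r := by
    intro n hn r hr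
    have hr0 : 0 < r := Nat.pos_of_mem_divisors hr
    have hrn : r ∣ n := (Nat.mem_divisors.mp hr).1
    have hnr : n / r * r = n := Nat.div_mul_cancel hrn
    have hd1 : 1 ≤ n / r := Nat.div_pos (Nat.le_of_dvd (Nat.pos_of_ne_zero hn) hrn) hr0
    refine ⟨hd1, hr0, by rw [hnr], ?_⟩
    rw [hNdef]; exact nSum13_eq_frakv2 c' χ hlog2 j hd1 hr0
  -- (10.8), relative: on all of `S₁`
  have hN8 : ∀ n ∈ S₁, ∀ r ∈ n.divisors,
      ‖N (n / r) r - c₀ * PiW χ (n / r) r * G n‖ ≤ |C₀| * (ell D ^ 15)⁻¹ * ((n : ℝ) / Nat.totient n) ^ 2 := by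
    intro n hn r hr
    obtain ⟨hn1, hnin⟩ := hmemS₁ hn
    obtain ⟨hd1, hr1, hcast, hNeq⟩ := hNfacts (hS₁ne n hn) r hr
    have h := H₁' (n / r) r hd1 hr1 (by rw [hcast]; exact hnin)
    rw [hrel (hS₁ne n hn) r hr] at h
    rw [hNeq, hGdef, hc₀def]
    simp only [mul_one]
    refine le_trans (le_of_eq ?_) (h.trans ?_)
    · congr 1; ring
    · have h15 : 0 ≤ (ell D ^ 15)⁻¹ * ((n : ℝ) / Nat.totient n) ^ 2 := by positivity
      calc C₁ * (ell D ^ 15)⁻¹ * ((n : ℝ) / Nat.totient n) ^ 2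
          = C₁ * ((ell D ^ 15)⁻¹ * ((n : ℝ) / Nat.totient n) ^ 2) := by ring
        _ ≤ |C₀| * ((ell D ^ 15)⁻¹ * ((n : ℝ) / Nat.totient n) ^ 2) :=
            mul_le_mul_of_nonneg_right ((le_abs_self _).trans (hC₀1.trans (le_abs_self _))) h15
        _ = |C₀| * (ell D ^ 15)⁻¹ * ((n : ℝ) / Nat.totient n) ^ 2 := by ring
  have hN : ∀ n ∈ S₁, main n → ∀ r ∈ n.divisors, Squarefree r →
      ‖N (n / r) r - c₀ * PiW χ (n / r) r * G n‖ ≤ |C₀| * (ell D ^ 15)⁻¹ * ((n : ℝ) / Nat.totient n) ^ 2 :=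
    fun n hn _ r hr _ => hN8 n hn r hr
  -- window-a: `‖N‖ ≤ (cc𝓛⁻⁷ + |C₀|𝓛⁻¹⁵)ρ²`
  set eWa : ℝ := cc * (ell D ^ 7)⁻¹ + |C₀| * (ell D ^ 15)⁻¹ with heWadef
  have hWa : ∀ n ∈ S₁, ¬ main n → ∀ r ∈ n.divisors, Squarefree r →
      ‖N (n / r) r‖ ≤ eWa * ((n : ℝ) / Nat.totient n) ^ 2 := by
    intro n hn _ r hr _
    have h := hN8 n hn r hr
    obtain ⟨hd1, hr1, hcast, -⟩ := hNfacts (hS₁ne n hn) r hr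
    have hPi := norm_PiW_le χ (d := n / r) (r := r) (by omega) (by omega)
    have hnr : n / r * r = n := Nat.div_mul_cancel (Nat.mem_divisors.mp hr).1
    rw [hnr] at hPi
    have hmain : ‖c₀ * PiW χ (n / r) r * G n‖ ≤ cc * (ell D ^ 7)⁻¹ * ((n : ℝ) / Nat.totient n) ^ 2 := by
      rw [hGdef]; simp only [mul_one]; rw [norm_mul]
      exact mul_le_mul hc₀' hPi (norm_nonneg _) (by positivity)
    have := norm_le_norm_add_norm_sub' (N (n / r) r) (c₀ * PiW χ (n / r) r * G n)
    rw [heWadef, add_mul]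
    linarith
  -- window-b: the weighted window clause
  set eWb : ℝ := |C₀| * (ell D * (1 + ell D ^ (1.1 : ℝ)) ^ 4 * (ell D ^ 9)⁻¹) with heWbdef
  have heWb0 : 0 ≤ eWb := by positivity
  have hWb : ∀ n ∈ S₂, ¬ False → ∀ r ∈ n.divisors, Squarefree r →
      ‖N (n / r) r‖ ≤ eWb * ((n : ℝ) / Nat.totient n) ^ 2 := by
    intro n hn _ r hr _
    obtain ⟨hn1, hlo, hnh⟩ := hmemS₂ hn
    obtain ⟨hd1, hr1, hcast, hNeq⟩ := hNfacts (hS₂ne n hn) r hr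
    have hwin : (bigP D ^ (0.5 : ℝ) / bigT D < ((n / r * r : ℕ) : ℝ) ∧
          ((n / r * r : ℕ) : ℝ) ≤ bigP D ^ (0.5 : ℝ)) ∨
        (bigP D ^ (0.502 : ℝ) / bigT D < ((n / r * r : ℕ) : ℝ) ∧
          ((n / r * r : ℕ) : ℝ) ≤ bigP D ^ (0.502 : ℝ)) ∨
        (bigP D ^ (0.504 : ℝ) / bigT D < ((n / r * r : ℕ) : ℝ) ∧
          ((n / r * r : ℕ) : ℝ) < bigP D ^ (0.504 : ℝ)) := by
      left; rw [hcast]; exact ⟨hlo, hnh.le⟩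
    have h := HW' (n / r) r hd1 hr1 hwin
    rw [hrel (hS₂ne n hn) r hr] at h
    rw [hNeq]
    refine h.trans ?_
    have h7 : 0 ≤ ell D * (1 + ell D ^ (1.1 : ℝ)) ^ 4 * (ell D ^ 9)⁻¹ * ((n : ℝ) / Nat.totient n) ^ 2 := by
      positivity
    calc Cw * (ell D * (1 + ell D ^ (1.1 : ℝ)) ^ 4 * (ell D ^ 9)⁻¹) * ((n : ℝ) / Nat.totient n) ^ 2
        = Cw * (ell D * (1 + ell D ^ (1.1 : ℝ)) ^ 4 * (ell D ^ 9)⁻¹ * ((n : ℝ) / Nat.totient n) ^ 2) := by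
          ring
      _ ≤ |C₀| * (ell D * (1 + ell D ^ (1.1 : ℝ)) ^ 4 * (ell D ^ 9)⁻¹ * ((n : ℝ) / Nat.totient n) ^ 2) :=
          mul_le_mul_of_nonneg_right ((le_abs_self _).trans (hC₀w.trans (le_abs_self _))) h7
      _ = eWb * ((n : ℝ) / Nat.totient n) ^ 2 := by rw [heWbdef]; ring
  -- (8.10)
  have hPi : ∀ n ∈ S₁, main n →
      ∑ r ∈ n.divisors with Squarefree r, (1 / (Nat.totient r : ℂ)) * PiW χ (n / r) r =
        (n : ℂ) / (Nat.totient n : ℂ) := fun n hn _ => h810 D χ hq n (hS₁ne n hn)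
  have hPi₂ : ∀ n ∈ S₂, False →
      ∑ r ∈ n.divisors with Squarefree r, (1 / (Nat.totient r : ℂ)) * PiW χ (n / r) r =
        (n : ℂ) / (Nat.totient n : ℂ) := fun n _ h => False.elim h
  ------------------------------------------------------------------
  -- the two assemblies
  ------------------------------------------------------------------
  have hM₀₁ : ∀ n ∈ S₁, ‖M₀ n‖ ≤ BM := fun n hn => hM₀ n (Finset.mem_of_mem_filter n hn)
  have hM₀₂ : ∀ n ∈ S₂, ‖M₀ n‖ ≤ BM := fun n hn => hM₀ n (Finset.mem_of_mem_filter n hn)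
  have hRA₁ := Sec10C.Ranges1422.range_assembly_bound₃ hS₁ne main a M M₀ G N (PiW χ) c₀ heM0 hBM0
    hBWa0 hPi hM hM₀₁ hMWa hG hN hWa
  have hRA₂ := Sec10C.Ranges1422.range_assembly_bound₃ (eN := 0) hS₂ne (fun _ => False) a M M₀ G N (PiW χ) c₀
    heM0 hBM0 hBWb0 hPi₂ (fun n _ h => False.elim h) hM₀₂ hMWb hG₂ (fun n _ h => False.elim h) hWb
  ------------------------------------------------------------------
  -- weights
  ------------------------------------------------------------------
  set w : ℕ → ℝ := fun n => ((n : ℝ) / Nat.totient n) ^ 7 / n with hw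
  have hw0 : ∀ n, 0 ≤ w n := fun n => by rw [hw]; positivity
  have hweight : ∀ n : ℕ, n ≠ 0 → ‖a n‖ * ((n : ℝ) / Nat.totient n) ^ 3 ≤ w n := by
    intro n hn0
    have hχ : ‖χ (n : ZMod D)‖ ≤ 1 := DirichletCharacter.norm_le_one χ _
    have hlam := norm_lamZero_le c' D j hn0
    have hr1 := one_le_self_div_totient hn0
    rw [hadef, hw]
    simp only
    rw [norm_div, norm_mul, Complex.norm_real, Real.norm_eq_abs, abs_norm, Complex.norm_natCast]
    calc ‖χ (n : ZMod D)‖ * ‖lamZero c' D j n‖ / n * ((n : ℝ) / Nat.totient n) ^ 3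
        ≤ 1 * ((n : ℝ) / Nat.totient n) ^ 4 / n * ((n : ℝ) / Nat.totient n) ^ 3 := by gcongr
      _ = ((n : ℝ) / Nat.totient n) ^ 7 / n := by ring
  -- main part of `S₁`: `n < P₂/T ≤ P^{0.5}`, from `n = 1`
  have hW₁main : ∑ n ∈ S₁.filter main, ‖a n‖ * ((n : ℝ) / Nat.totient n) ^ 3 ≤
      2 * Real.exp 256 * ell D ^ 9 := by
    set Xn : ℕ := ⌊bigP D ^ (0.5 : ℝ)⌋₊ with hXn
    have hXn1 : 1 ≤ Xn := Nat.one_le_iff_ne_zero.mpr (Nat.floor_pos.mpr hhalf1).ne'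
    have hsub : S₁.filter main ⊆ Finset.Icc 1 Xn := by
      intro n hn
      have hn' := Finset.mem_of_mem_filter n hn
      obtain ⟨hn1, hnin⟩ := hmemS₁ hn'
      rw [Finset.mem_Icc]
      exact ⟨hn1, Nat.le_floor (hnin.trans hhalfT_lt_half.le)⟩
    have hlogX : Real.log (Xn : ℝ) ≤ 0.5 * ell D ^ 9 := by
      have hXpos : (0 : ℝ) < Xn := by exact_mod_cast hXn1
      calc Real.log (Xn : ℝ) ≤ Real.log (bigP D ^ (0.5 : ℝ)) :=
            Real.log_le_log hXpos (Nat.floor_le hhalf0.le)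
        _ = 0.5 * ell D ^ 9 := log_bigP_rpow D 0.5
    calc ∑ n ∈ S₁.filter main, ‖a n‖ * ((n : ℝ) / Nat.totient n) ^ 3
        ≤ ∑ n ∈ S₁.filter main, w n :=
          Finset.sum_le_sum fun n hn => hweight n (hS₁ne n (Finset.mem_of_mem_filter n hn))
      _ ≤ ∑ n ∈ Finset.Icc 1 Xn, w n := Finset.sum_le_sum_of_subset_of_nonneg hsub fun n _ _ => hw0 n
      _ ≤ 1 + Real.exp 256 * (1 + Real.log Xn) := Sec12C.sum_Icc_ratio7_le' hXn1
      _ ≤ 1 + Real.exp 256 * (1 + 0.5 * ell D ^ 9) := by gcongr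
      _ ≤ 2 * Real.exp 256 * ell D ^ 9 := by
          have he : 1 ≤ Real.exp 256 := Real.one_le_exp (by norm_num)
          have t := mul_le_mul_of_nonneg_left h59 (Real.exp_pos 256).le
          linarith
  -- window-a of `S₁`: `P₂/T ≤ n ≤ P^{0.5}/T`
  have hW₁win : ∑ n ∈ S₁.filter (fun n => ¬ main n), ‖a n‖ * ((n : ℝ) / Nat.totient n) ^ 3 ≤
      12 * Real.exp 256 * ell D ^ 2 := by
    set Y : ℕ := ⌈Skeleton.P2 D / bigT D⌉₊ - 1 with hY
    set Xn : ℕ := ⌊bigP D ^ (0.5 : ℝ) / bigT D⌋₊ with hXn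
    have hY2 : 2 ≤ ⌈Skeleton.P2 D / bigT D⌉₊ :=
      Nat.lt_ceil.mpr (by exact_mod_cast (show (1 : ℝ) < Skeleton.P2 D / bigT D by linarith))
    have hYpos : 0 < Y := by rw [hY]; omega
    have hYR : (1 : ℝ) ≤ Y := by exact_mod_cast hYpos
    have hYle : (Y : ℝ) ≥ Skeleton.P2 D / bigT D - 1 := by
      rw [hY, Nat.cast_sub (by omega), Nat.cast_one]
      linarith [Nat.le_ceil (Skeleton.P2 D / bigT D)]
    have hYlt : (Y : ℝ) < Skeleton.P2 D / bigT D := by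
      rw [hY]
      have := Nat.ceil_lt_add_one (show 0 ≤ Skeleton.P2 D / bigT D by positivity)
      have h1 : ((⌈Skeleton.P2 D / bigT D⌉₊ - 1 : ℕ) : ℝ) = (⌈Skeleton.P2 D / bigT D⌉₊ : ℝ) - 1 := by
        rw [Nat.cast_sub (by omega), Nat.cast_one]
      rw [h1]; linarith
    have hYX : Y ≤ Xn := by
      rw [hXn]
      exact Nat.le_floor (hYlt.le.trans hP2T_lt_halfT.le)
    have hsub : S₁.filter (fun n => ¬ main n) ⊆ Finset.Ioc Y Xn := by
      intro n hn
      rw [Finset.mem_filter] at hn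
      obtain ⟨hn', hnm⟩ := hn
      obtain ⟨hn1, hnin⟩ := hmemS₁ hn'
      rw [hmaindef] at hnm
      rw [Finset.mem_Ioc]
      refine ⟨?_, Nat.le_floor hnin⟩
      exact_mod_cast (hYlt.trans_le (not_lt.mp hnm) : (Y : ℝ) < n)
    have hsum := sum_ratio_pow_div_le 7 hYpos hYX
    have h256 : Real.exp (2 ^ (7 + 1)) = Real.exp 256 := by norm_num
    rw [h256] at hsum
    -- `1 + log Xn − log Y ≤ 2 + 11·𝓛^{1.1}`
    have hlogXn : Real.log (Xn : ℝ) ≤ 0.5 * ell D ^ 9 - ell D ^ (1.1 : ℝ) := by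
      have hXpos : (0 : ℝ) < Xn := by exact_mod_cast (lt_of_lt_of_le hYpos hYX)
      calc Real.log (Xn : ℝ) ≤ Real.log (bigP D ^ (0.5 : ℝ) / bigT D) :=
            Real.log_le_log hXpos (Nat.floor_le (by positivity))
        _ = _ := by rw [hhalfT_exp, Real.log_exp]
    have hlogY : 0.5 * ell D ^ 9 - 11 * ell D ^ (1.1 : ℝ) - Real.log 2 ≤ Real.log (Y : ℝ) := by
      have h2Y : Skeleton.P2 D / bigT D / 2 ≤ Y := by linarith
      calc 0.5 * ell D ^ 9 - 11 * ell D ^ (1.1 : ℝ) - Real.log 2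
          = Real.log (Skeleton.P2 D / bigT D / 2) := by
            rw [Real.log_div (by positivity) (by norm_num), hP2T_exp, Real.log_exp]
        _ ≤ Real.log (Y : ℝ) := Real.log_le_log (by positivity) h2Y
    calc ∑ n ∈ S₁.filter (fun n => ¬ main n), ‖a n‖ * ((n : ℝ) / Nat.totient n) ^ 3
        ≤ ∑ n ∈ S₁.filter (fun n => ¬ main n), w n :=
          Finset.sum_le_sum fun n hn => hweight n (hS₁ne n (Finset.mem_of_mem_filter n hn))
      _ ≤ ∑ n ∈ Finset.Ioc Y Xn, w n := Finset.sum_le_sum_of_subset_of_nonneg hsub fun n _ _ => hw0 n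
      _ ≤ Real.exp 256 * (1 + Real.log Xn - Real.log Y) := hsum
      _ ≤ Real.exp 256 * (2 + 10 * ell D ^ (1.1 : ℝ)) := by
          gcongr; linarith [Real.log_two_lt_d9]
      _ ≤ 12 * Real.exp 256 * ell D ^ 2 := by
          have h2 : (1 : ℝ) ≤ ell D ^ 2 := one_le_pow₀ hL1
          have h3 : 2 + 10 * ell D ^ (1.1 : ℝ) ≤ 12 * ell D ^ 2 := by linarith
          have t := mul_le_mul_of_nonneg_left h3 (Real.exp_pos 256).le
          linarith
  -- `S₂`: the window `P^{0.5}/T < n < P^{0.5}`, sharp mass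
  have hW₂filt : S₂.filter (fun _ => ¬ False) = S₂ := Finset.filter_true_of_mem fun _ _ => not_false
  have hW₂main : S₂.filter (fun _ => False) = ∅ := Finset.filter_false_of_mem fun _ _ => not_false
  have hW₂win : ∑ n ∈ S₂.filter (fun _ => ¬ False), ‖a n‖ * ((n : ℝ) / Nat.totient n) ^ 3 ≤
      Real.exp 256 * (5 + ell D ^ (1.1 : ℝ)) := by
    rw [hW₂filt]
    have hwin := weight_sum_windows 7 (A := 0.5 * ell D ^ 9) (B := 0.5 * ell D ^ 9)
      (τ := ell D ^ (1.1 : ℝ)) (by linarith [h59]) hτ0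
      (by have h2pos : 0 < ell D ^ 2 := pow_pos hL0 2
          linarith [h11, h7L])
      S₂ (fun n hn => by
        obtain ⟨h1, h2, h3⟩ := hmemS₂ hn
        refine ⟨h1, Or.inr ⟨?_, ?_⟩⟩
        · rw [← hhalfT_exp]; exact h2.le
        · rw [← hhalf_exp]; exact h3)
    have h256 : Real.exp (2 ^ (7 + 1)) = Real.exp 256 := by norm_num
    rw [h256] at hwin
    calc ∑ n ∈ S₂, ‖a n‖ * ((n : ℝ) / Nat.totient n) ^ 3 ≤ ∑ n ∈ S₂, w n :=
          Finset.sum_le_sum fun n hn => hweight n (hS₂ne n hn)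
      _ ≤ Real.exp 256 * (5 + ell D ^ (1.1 : ℝ)) := hwin
  ------------------------------------------------------------------
  -- constants
  ------------------------------------------------------------------
  have hBMeM : BM + eM ≤ (174 * cL + KeM) * (ell D ^ 7)⁻¹ := by
    rw [hBMdef, heMdef, add_mul]
    have h1 : cL * ell D ^ 2 * 174 / ell D ^ 9 = 174 * cL * (ell D ^ 7)⁻¹ := by field_simp
    have h2 : (ell D ^ 14)⁻¹ ≤ (ell D ^ 7)⁻¹ := by
      rw [inv_le_inv₀ (by positivity) (by positivity)]; exact pow_le_pow_right₀ hL1 (by norm_num)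
    rw [h1]
    have := mul_le_mul_of_nonneg_left h2 hKeM0
    linarith
  have hA₁ : (BM + eM) * (|C₀| * (ell D ^ 15)⁻¹) + eM * ‖c₀‖ * 1 ≤ K₁ * (ell D ^ 21)⁻¹ := by
    rw [abs_of_nonneg hC₀0]
    have t1 : (BM + eM) * (C₀ * (ell D ^ 15)⁻¹) ≤ (174 * cL + KeM) * C₀ * (ell D ^ 21)⁻¹ := by
      calc (BM + eM) * (C₀ * (ell D ^ 15)⁻¹) ≤ ((174 * cL + KeM) * (ell D ^ 7)⁻¹) * (C₀ * (ell D ^ 15)⁻¹) :=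
            mul_le_mul_of_nonneg_right hBMeM (by positivity)
        _ = (174 * cL + KeM) * C₀ * ((ell D ^ 7)⁻¹ * (ell D ^ 15)⁻¹) := by ring
        _ ≤ (174 * cL + KeM) * C₀ * (ell D ^ 21)⁻¹ := by
            gcongr
            rw [← mul_inv, ← pow_add, inv_le_inv₀ (by positivity) (by positivity)]
            exact pow_le_pow_right₀ hL1 (by norm_num)
    have t2 : eM * ‖c₀‖ * 1 ≤ KeM * cc * (ell D ^ 21)⁻¹ := by
      rw [mul_one, heMdef]
      calc KeM * (ell D ^ 14)⁻¹ * ‖c₀‖ ≤ KeM * (ell D ^ 14)⁻¹ * (cc * (ell D ^ 7)⁻¹) := by gcongr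
        _ = KeM * cc * ((ell D ^ 14)⁻¹ * (ell D ^ 7)⁻¹) := by ring
        _ = KeM * cc * (ell D ^ 21)⁻¹ := by rw [← mul_inv, ← pow_add]
    rw [hK₁, add_mul]
    linarith
  have hA₂ : BWa * eWa + BM * ‖c₀‖ * 1 ≤ K₂ * (ell D ^ 12)⁻¹ := by
    have t1 : BWa * eWa ≤ (58 * cL + |C₄₀| + 10) * (cc + C₀) * (ell D ^ 12)⁻¹ := by
      rw [hBWadef, heWadef, abs_of_nonneg hC₀0]
      have h15 : (ell D ^ 15)⁻¹ ≤ (ell D ^ 7)⁻¹ := by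
        rw [inv_le_inv₀ (by positivity) (by positivity)]; exact pow_le_pow_right₀ hL1 (by norm_num)
      calc (58 * cL + |C₄₀| + 10) * (ell D ^ 5)⁻¹ * (cc * (ell D ^ 7)⁻¹ + C₀ * (ell D ^ 15)⁻¹)
          ≤ (58 * cL + |C₄₀| + 10) * (ell D ^ 5)⁻¹ * (cc * (ell D ^ 7)⁻¹ + C₀ * (ell D ^ 7)⁻¹) := by
            gcongr
        _ = (58 * cL + |C₄₀| + 10) * (cc + C₀) * ((ell D ^ 5)⁻¹ * (ell D ^ 7)⁻¹) := by ring
        _ = (58 * cL + |C₄₀| + 10) * (cc + C₀) * (ell D ^ 12)⁻¹ := by rw [← mul_inv, ← pow_add]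
    have t2 : BM * ‖c₀‖ * 1 ≤ 174 * cL * cc * (ell D ^ 12)⁻¹ := by
      rw [mul_one, hBMdef]
      calc cL * ell D ^ 2 * 174 / ell D ^ 9 * ‖c₀‖ ≤ cL * ell D ^ 2 * 174 / ell D ^ 9 * (cc * (ell D ^ 7)⁻¹) := by
            gcongr
        _ = 174 * cL * cc * (ell D ^ 14)⁻¹ := by field_simp
        _ ≤ 174 * cL * cc * (ell D ^ 12)⁻¹ := by
            apply mul_le_mul_of_nonneg_left _ (by positivity)
            rw [inv_le_inv₀ (by positivity) (by positivity)]; exact pow_le_pow_right₀ hL1 (by norm_num)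
    rw [hK₂, add_mul]
    linarith
  have hA₂b : BWb * eWb + BM * ‖c₀‖ * 1 ≤
      Ka * (ell D * (1 + ell D ^ (1.1 : ℝ)) ^ 4 / ell D ^ 9) * (ell D ^ 7)⁻¹ + Kb * (ell D ^ 14)⁻¹ := by
    have t1 : BWb * eWb ≤ Ka * (ell D * (1 + ell D ^ (1.1 : ℝ)) ^ 4 / ell D ^ 9) * (ell D ^ 7)⁻¹ := by
      rw [hBWbdef, heWbdef, hKa, abs_of_nonneg hC₀0]
      have h15 : (ell D ^ 15)⁻¹ ≤ (ell D ^ 7)⁻¹ := by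
        rw [inv_le_inv₀ (by positivity) (by positivity)]; exact pow_le_pow_right₀ hL1 (by norm_num)
      have hB : 58 * cL * (ell D ^ 7)⁻¹ + |C₄₀| * (ell D ^ 15)⁻¹ ≤ (58 * cL + |C₄₀|) * (ell D ^ 7)⁻¹ := by
        rw [add_mul]; gcongr
      calc (58 * cL * (ell D ^ 7)⁻¹ + |C₄₀| * (ell D ^ 15)⁻¹) *
            (C₀ * (ell D * (1 + ell D ^ (1.1 : ℝ)) ^ 4 * (ell D ^ 9)⁻¹))
          ≤ ((58 * cL + |C₄₀|) * (ell D ^ 7)⁻¹) * (C₀ * (ell D * (1 + ell D ^ (1.1 : ℝ)) ^ 4 * (ell D ^ 9)⁻¹)) :=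
            mul_le_mul_of_nonneg_right hB (by positivity)
        _ = (58 * cL + |C₄₀|) * C₀ * (ell D * (1 + ell D ^ (1.1 : ℝ)) ^ 4 / ell D ^ 9) * (ell D ^ 7)⁻¹ := by
            ring
    have t2 : BM * ‖c₀‖ * 1 ≤ Kb * (ell D ^ 14)⁻¹ := by
      rw [mul_one, hBMdef, hKb]
      calc cL * ell D ^ 2 * 174 / ell D ^ 9 * ‖c₀‖ ≤ cL * ell D ^ 2 * 174 / ell D ^ 9 * (cc * (ell D ^ 7)⁻¹) := by
            gcongr
        _ = 174 * cL * cc * (ell D ^ 14)⁻¹ := by field_simp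
    linarith
  ------------------------------------------------------------------
  -- conclusion
  ------------------------------------------------------------------
  -- split both sums at `P^{0.5}/T`
  have hreidx : Sec10B.drSum c' χ j M N 0 (bigP D ^ (0.5 : ℝ)) =
      ∑ n ∈ S, ∑ r ∈ n.divisors,
        (if Squarefree r then a n / (Nat.totient r : ℂ) * M n * N (n / r) r else 0) := by
    rw [hadef]; exact hreidx0
  have hMT : deriv χ.LFunction 1 ^ 2 / 500 * (betaJ c' D (j + 1) * betaJ c' D (j + 2)) *
        Sec10B.nAvg c' χ j 0 (bigP D ^ (0.5 : ℝ)) (fun n =>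
          frakfW c' D j 6 (bigP D ^ (0.504 : ℝ) / n) / 0.504 +
            iota2 * frakfW c' D j 7 (bigP D ^ (0.5 : ℝ) / n) / 0.5) =
      ∑ n ∈ S, a n * ((n : ℂ) / (Nat.totient n : ℂ)) * (M₀ n * c₀ * G n) := by
    rw [hadef, hM₀def, hGdef, hc₀def]
    exact hMT0
  rw [hreidx, hMT]
  set Lf : ℕ → ℂ := fun n => ∑ r ∈ n.divisors,
    (if Squarefree r then a n / (Nat.totient r : ℂ) * M n * N (n / r) r else 0) with hLf
  set Rf : ℕ → ℂ := fun n => a n * ((n : ℂ) / (Nat.totient n : ℂ)) * (M₀ n * c₀ * G n) with hRf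
  have hsplitL : ∑ n ∈ S, Lf n = ∑ n ∈ S₁, Lf n + ∑ n ∈ S₂, Lf n :=
    (Finset.sum_filter_add_sum_filter_not S inner Lf).symm
  have hsplitR : ∑ n ∈ S, Rf n = ∑ n ∈ S₁, Rf n + ∑ n ∈ S₂, Rf n :=
    (Finset.sum_filter_add_sum_filter_not S inner Rf).symm
  have e : ∑ n ∈ S, Lf n - ∑ n ∈ S, Rf n =
      (∑ n ∈ S₁, Lf n - ∑ n ∈ S₁, Rf n) + (∑ n ∈ S₂, Lf n - ∑ n ∈ S₂, Rf n) := by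
    rw [hsplitL, hsplitR]; ring
  rw [e]
  refine (norm_add_le _ _).trans ?_
  rw [hαeq]
  -- thresholds
  have hεh : 0 < ε / 2 := by linarith
  have hX₁ : 2 * (2 * Real.exp 256 * K₁ + 12 * Real.exp 256 * K₂) / (ε * π) ≤ ell D := by
    rw [hX] at hLX
    have h2 : 0 ≤ 2 * (3 * Real.exp 256 * 0 + 6 * Real.exp 256 * Kb) / (ε / 2 * π) := by positivity
    linarith [sq_nonneg (2 * (160 * Real.exp 256 * Ka) / (ε / 2 * π))]
  have hX₂ : 2 * (3 * Real.exp 256 * 0 + 6 * Real.exp 256 * Kb) / (ε / 2 * π) ≤ ell D := by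
    rw [hX] at hLX
    have h1 : 0 ≤ 2 * (2 * Real.exp 256 * K₁ + 12 * Real.exp 256 * K₂) / (ε * π) := by positivity
    linarith [sq_nonneg (2 * (160 * Real.exp 256 * Ka) / (ε / 2 * π))]
  have hX₃ : (2 * (160 * Real.exp 256 * Ka) / (ε / 2 * π)) ^ 2 ≤ ell D := by
    rw [hX] at hLX
    have h1 : 0 ≤ 2 * (2 * Real.exp 256 * K₁ + 12 * Real.exp 256 * K₂) / (ε * π) := by positivity
    have h2 : 0 ≤ 2 * (3 * Real.exp 256 * 0 + 6 * Real.exp 256 * Kb) / (ε / 2 * π) := by positivity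
    linarith
  have piece1 : ‖∑ n ∈ S₁, Lf n - ∑ n ∈ S₁, Rf n‖ ≤ ε / 2 * (π / ell D ^ 9) := by
    refine hRA₁.trans ?_
    exact final_bound_low hL1 hε hK₁0 hK₂0 (by positivity) (by positivity) hW₁main hW₁win hA₁ hA₂ hX₁
  have piece2 : ‖∑ n ∈ S₂, Lf n - ∑ n ∈ S₂, Rf n‖ ≤ ε / 2 * (π / ell D ^ 9) := by
    refine hRA₂.trans ?_
    rw [hW₂main, Finset.sum_empty, zero_mul, zero_add]
    have h := final_bound_D3 (W₁ := 0) (A₁ := 0) (K₁ := 0) hL1 hεh le_rfl hKa0 hKb0 le_rfl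
      (by positivity) (by positivity) hW₂win (by simp) hA₂b hX₂ hX₃
    simpa using h
  linarith

/-- **`Z22:§10.u036` (first line) HOLDS** for the manuscript's parameter range `c′ ≥ 0`:
`Typed.Sec10B.Eq1036a c′` — every input of `eq1036a_of_clauses` is a tree theorem: (10.8) in relative
form (`Lemma102.eq108Rel_of_lemma83Rel`) and the weighted window bound
(`Lemma102.frakv2_windows_le_of_lemma83Rel`) from Lemma 8.3 in relative form (`Skeleton.lemma83Rel_holds`);
`Z22:§8.u040/u041` (`Section8FrontEnd82.step8u040_holds` / `step8u041_holds`) and (8.10) (`eq810_holds`).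
[cite: Zhang2022LandauSiegel, §10 p. 57] -/
theorem _root_.Literature.NumberTheory.LFunctions.Zhang2022.Typed.Sec10B.eq1036a_holds {c' : ℝ}
    (hc' : 0 ≤ c') : Sec10B.Eq1036a c' :=
  eq1036a_of_clauses c' (Lemma102.eq108Rel_of_lemma83Rel (lemma83Rel_holds c'))
    (Lemma102.frakv2_windows_le_of_lemma83Rel (lemma83Rel_holds c'))
    (Section8FrontEnd82.step8u040_holds hc') (Section8FrontEnd82.step8u041_holds hc')
    Section8FrontEnd810.eq810_holds

end Literature.NumberTheory.LFunctions.Zhang2022.Range1113Rel
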